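import Summits.ResolutionOfSingularities.ResolutionOfSingularities.Theorems.PurelyInseparableDim4ResConeDInfPotential
import Summits.ResolutionOfSingularities.ResolutionOfSingularities.Theorems.PurelyInseparableDim4ResConeDInfKeepStep
import HarnessLib
import HarnessLib.Audit.Tags

/-!
# Purely inseparable four-folds — the D∞ HEAVY-LINE ASSEMBLY at `(p,d) = (5,4)`, INSTANTIATED: TAIL-D's D∞ branch is empty GIVEN
# the entry law E₄ and the LOSE-H law L₄ of the carried heavy label; the KEEP-H law K₄ is the tree's `ResCone.dInf_stub_keep`
# (cell `res-dim4-pi`, K2(p) lane, slice C `(5,4)`; CARD I-1-9/I-1-10 «THE HEAVY LINE»)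

[OURS · counted 0 · cell `res-dim4-pi` · K2(p) lane (holder res-dim4-p-12 g4; desk WORD #182 (ii) «K₄ chain-level + …DInfPotential =
p-7 g5»); the `μ = 4` twin of res-dim4-p-9 g4's `ResCone.no_bInf_tail_three_five_of_KL` (p703425); kernel hand res-dim4-p-7 g5.]
Nothing here proves TAIL-D, K2(5), `NoIsolatedTrap 5 5` or resolution of singularities in dimension ≥ 4 / characteristic `p` — NOT
proved; E₄ (entry frame at a `(2,1)`-state, res-dim4-p-9's twin of `stub_entryFrame`) and L₄ (LOSE-H law, res-dim4-p-2 g5's twin of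
`bInf_stub_lose`) are HYPOTHESES here, stated with the heavy-line invariants EntryInv₄ / RunInv₄ UNFOLDED (bus 2026-08-29 07:29Z):
frame `L` with left inverse `M`, `L u₁ = e_h` for the HEAVY letter `h` (`r_k h = 2`), y-rows annihilating `resVertex (c k)`, and for
`(G_k)`, `G_k = F_k / x^{r_k}`, read at level `4` in the frame: `pts ≠ ∅`, `4! < δs`, `2·αs ≤ 4!` (RunInv₄ adds `0 < αs`); `Φ = βs`.
AI kernel work, weaker than expert review.

* **`no_dInf_tail_four_five_of_EL (hE) (hL)`** — on TAIL-D data (isolated witnessed `Step0 5` chain, `x^{r₀} ∣ F₀`, off the floor,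
  shade `4` and `e_G = 2` from `k₀`) in the D∞ branch from `k₁ ≥ k₀` (one weight-`2` letter, the others `≤ 1`, `|r| ∈ {2,3}`): `False`, by
  `no_dInf_tail_of_potential` with datum (heavy letter, frame, inverse), `E := EntryInv₄`, `R := RunInv₄`, `Φ := betaS`, (K₄) =
  `dInf_stub_keep`;
* **`tailD_four_five_of_lightPair_of_EL (hlight) (hE) (hL)`** — hence the socket's TAIL-D for the chain GIVEN a light-pair kill
  (hN4-C′'s business) and E₄/L₄ (`four_weights_dichotomy`).
[cite: CossartJannsenSaito2020, Thm. 3.14, Lemma 13.4 (3), Thm. 13.7] [cite: CossartPiltant2008, (16)]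
bears_on: LADDER-RESOLUTION:D157-DOOR2 (res-dim4-pi · K2(p) · slice C `(5,4)` D∞ heavy-line assembly, instantiated).  Supports
stmt-ResolutionOfSingularities-16155 (helper).
-/

set_option linter.dupNamespace false -- mandated namespace of this single-conjunct summit

noncomputable section

namespace Summit.ResolutionOfSingularities.ResolutionOfSingularities.Theorems.PIDim4

namespace ResCone

open MvPolynomial Finset
open Literature.AlgebraicGeometry.Resolution
open Literature.AlgebraicGeometry.Resolution.CentreBlowup
open Literature.AlgebraicGeometry.Resolution.Hauser2010
open Literature.AlgebraicGeometry.Resolution.HauserPerlega2019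
open Literature.AlgebraicGeometry.Resolution.WeightedOrder

variable {K : Type} [Field K] [CharP K 5] [DecidableEq K]

/-- **THE D∞ HEAVY-LINE ASSEMBLY, INSTANTIATED, MODULO E₄ AND L₄.**  On TAIL-D data in the D∞ branch from `k₁ ≥ k₀`, ASSUMING
the entry law `hE` (at a `(2,1)`-state with heavy letter `W` an EntryInv₄ frame exists) and the LOSE-H law `hL` (at a `(2,1)`-state
an EntryInv₄ frame passes to a RunInv₄ frame of the child with heavy letter `j k` and `betaS` not larger), the chain cannot exist —
`no_dInf_tail_of_potential` with `E := EntryInv₄`, `R := RunInv₄`, `Φ := betaS`, the KEEP-H law being `dInf_stub_keep`. [OURS]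
[cite: CossartJannsenSaito2020, Lemma 13.4 (3), Thm. 13.7] [cite: CossartPiltant2008, (16)] -/
theorem no_dInf_tail_four_five_of_EL {c : ℕ → State K} {j : ℕ → Fin 4} {b : ℕ → Fin 4 → K}
    (hc : ∀ k, IsIsolated 5 (c k).F ∧ Step0 5 (c k) (c (k + 1))) (hw : FreeTail.IsWitnessedChain 5 c j b)
    (hr0 : ∀ e ∈ (c 0).F.support, (c 0).r ≤ e) (hfloor : ∀ k, ordZero (c k).F ≠ 5) {k₀ : ℕ}
    (hshade : ∀ k, k₀ ≤ k → (c k).shade = ((4 : ℕ) : ℕ∞))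
    (he : ∀ k, k₀ ≤ k → Module.finrank K (resVertex (c k)) = 2) {k₁ : ℕ} (hk₁ : k₀ ≤ k₁)
    (hD : ∀ k, k₁ ≤ k → (∃ W, (c k).r W = 2 ∧ ∀ i, i ≠ W → (c k).r i ≤ 1) ∧
      (2 ≤ (c k).r.degree ∧ (c k).r.degree ≤ 3))
    (hE : ∀ k, k₀ ≤ k → (c k).r.degree = 3 → ∀ (W : Fin 4), (c k).r W = 2 →
      ∃ (L : Fin (2 + 2) → Fin 4 → K) (M : Fin 4 → Fin (2 + 2) → K),
        (∀ t u, ∑ i, M t i * L i u = if t = u then 1 else 0) ∧ L (u1 2) = Pi.single W 1 ∧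
        (∀ i, i ≠ u1 2 → i ≠ u2 2 → ∀ w ∈ resVertex (c k), ∑ t, L i t * w t = 0) ∧ (c k).r W = 2 ∧
        (pts (fun i => algebraMap (MvPolynomial (Fin 4) K) (OriginLocalization K 4) (∑ t, C (L i t) * X t))
          (Ideal.span {algebraMap (MvPolynomial (Fin 4) K) (OriginLocalization K 4)
            ((c k).F.divMonomial (c k).r)}) 4).Nonempty ∧
        Nat.factorial 4 < deltaS (fun i => algebraMap (MvPolynomial (Fin 4) K) (OriginLocalization K 4) (∑ t, C (L i t) * X t))
          (Ideal.span {algebraMap (MvPolynomial (Fin 4) K) (OriginLocalization K 4)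
            ((c k).F.divMonomial (c k).r)}) 4 ∧
        2 * alphaS (fun i => algebraMap (MvPolynomial (Fin 4) K) (OriginLocalization K 4) (∑ t, C (L i t) * X t))
          (Ideal.span {algebraMap (MvPolynomial (Fin 4) K) (OriginLocalization K 4)
            ((c k).F.divMonomial (c k).r)}) 4 ≤ Nat.factorial 4)
    (hL : ∀ k, k₀ ≤ k → (c k).r.degree = 3 → ∀ (h : Fin 4) (L : Fin (2 + 2) → Fin 4 → K) (M : Fin 4 → Fin (2 + 2) → K),
      ((∀ t u, ∑ i, M t i * L i u = if t = u then 1 else 0) ∧ L (u1 2) = Pi.single h 1 ∧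
        (∀ i, i ≠ u1 2 → i ≠ u2 2 → ∀ w ∈ resVertex (c k), ∑ t, L i t * w t = 0) ∧ (c k).r h = 2 ∧
        (pts (fun i => algebraMap (MvPolynomial (Fin 4) K) (OriginLocalization K 4) (∑ t, C (L i t) * X t))
          (Ideal.span {algebraMap (MvPolynomial (Fin 4) K) (OriginLocalization K 4)
            ((c k).F.divMonomial (c k).r)}) 4).Nonempty ∧
        Nat.factorial 4 < deltaS (fun i => algebraMap (MvPolynomial (Fin 4) K) (OriginLocalization K 4) (∑ t, C (L i t) * X t))
          (Ideal.span {algebraMap (MvPolynomial (Fin 4) K) (OriginLocalization K 4)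
            ((c k).F.divMonomial (c k).r)}) 4 ∧
        2 * alphaS (fun i => algebraMap (MvPolynomial (Fin 4) K) (OriginLocalization K 4) (∑ t, C (L i t) * X t))
          (Ideal.span {algebraMap (MvPolynomial (Fin 4) K) (OriginLocalization K 4)
            ((c k).F.divMonomial (c k).r)}) 4 ≤ Nat.factorial 4) →
      ∃ (L' : Fin (2 + 2) → Fin 4 → K) (M' : Fin 4 → Fin (2 + 2) → K),
        (((∀ t u, ∑ i, M' t i * L' i u = if t = u then 1 else 0) ∧ L' (u1 2) = Pi.single (j k) 1 ∧
            (∀ i, i ≠ u1 2 → i ≠ u2 2 → ∀ w ∈ resVertex (c (k + 1)), ∑ t, L' i t * w t = 0) ∧ (c (k + 1)).r (j k) = 2 ∧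
            (pts (fun i => algebraMap (MvPolynomial (Fin 4) K) (OriginLocalization K 4) (∑ t, C (L' i t) * X t))
              (Ideal.span {algebraMap (MvPolynomial (Fin 4) K) (OriginLocalization K 4)
            ((c (k + 1)).F.divMonomial (c (k + 1)).r)}) 4).Nonempty ∧
            Nat.factorial 4 < deltaS (fun i => algebraMap (MvPolynomial (Fin 4) K) (OriginLocalization K 4) (∑ t, C (L' i t) * X t))
              (Ideal.span {algebraMap (MvPolynomial (Fin 4) K) (OriginLocalization K 4)
            ((c (k + 1)).F.divMonomial (c (k + 1)).r)}) 4 ∧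
            2 * alphaS (fun i => algebraMap (MvPolynomial (Fin 4) K) (OriginLocalization K 4) (∑ t, C (L' i t) * X t))
              (Ideal.span {algebraMap (MvPolynomial (Fin 4) K) (OriginLocalization K 4)
            ((c (k + 1)).F.divMonomial (c (k + 1)).r)}) 4 ≤ Nat.factorial 4) ∧
          0 < alphaS (fun i => algebraMap (MvPolynomial (Fin 4) K) (OriginLocalization K 4) (∑ t, C (L' i t) * X t))
            (Ideal.span {algebraMap (MvPolynomial (Fin 4) K) (OriginLocalization K 4)
            ((c (k + 1)).F.divMonomial (c (k + 1)).r)}) 4) ∧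
        betaS (fun i => algebraMap (MvPolynomial (Fin 4) K) (OriginLocalization K 4) (∑ t, C (L' i t) * X t))
          (Ideal.span {algebraMap (MvPolynomial (Fin 4) K) (OriginLocalization K 4)
            ((c (k + 1)).F.divMonomial (c (k + 1)).r)}) 4 ≤
          betaS (fun i => algebraMap (MvPolynomial (Fin 4) K) (OriginLocalization K 4) (∑ t, C (L i t) * X t))
          (Ideal.span {algebraMap (MvPolynomial (Fin 4) K) (OriginLocalization K 4)
            ((c k).F.divMonomial (c k).r)}) 4) : False := by
  -- datum = (heavy letter, frame, inverse); `E` = EntryInv₄, `R` = RunInv₄, `Φ` = betaS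
  refine no_dInf_tail_of_potential hc hw hr0 hfloor hshade hk₁ hD
    (Fr := Fin 4 × ((Fin (2 + 2) → Fin 4 → K) × (Fin 4 → Fin (2 + 2) → K)))
    (fun k f =>
      (∀ t u, ∑ i, f.2.2 t i * f.2.1 i u = if t = u then 1 else 0) ∧ f.2.1 (u1 2) = Pi.single f.1 1 ∧
      (∀ i, i ≠ u1 2 → i ≠ u2 2 → ∀ w ∈ resVertex (c k), ∑ t, f.2.1 i t * w t = 0) ∧ (c k).r f.1 = 2 ∧
      (pts (fun i => algebraMap (MvPolynomial (Fin 4) K) (OriginLocalization K 4) (∑ t, C (f.2.1 i t) * X t))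
        (Ideal.span {algebraMap (MvPolynomial (Fin 4) K) (OriginLocalization K 4)
            ((c k).F.divMonomial (c k).r)}) 4).Nonempty ∧
      Nat.factorial 4 < deltaS (fun i => algebraMap (MvPolynomial (Fin 4) K) (OriginLocalization K 4) (∑ t, C (f.2.1 i t) * X t))
        (Ideal.span {algebraMap (MvPolynomial (Fin 4) K) (OriginLocalization K 4)
            ((c k).F.divMonomial (c k).r)}) 4 ∧
      2 * alphaS (fun i => algebraMap (MvPolynomial (Fin 4) K) (OriginLocalization K 4) (∑ t, C (f.2.1 i t) * X t))
        (Ideal.span {algebraMap (MvPolynomial (Fin 4) K) (OriginLocalization K 4)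
            ((c k).F.divMonomial (c k).r)}) 4 ≤ Nat.factorial 4)
    (fun k f =>
      ((∀ t u, ∑ i, f.2.2 t i * f.2.1 i u = if t = u then 1 else 0) ∧ f.2.1 (u1 2) = Pi.single f.1 1 ∧
        (∀ i, i ≠ u1 2 → i ≠ u2 2 → ∀ w ∈ resVertex (c k), ∑ t, f.2.1 i t * w t = 0) ∧ (c k).r f.1 = 2 ∧
        (pts (fun i => algebraMap (MvPolynomial (Fin 4) K) (OriginLocalization K 4) (∑ t, C (f.2.1 i t) * X t))
          (Ideal.span {algebraMap (MvPolynomial (Fin 4) K) (OriginLocalization K 4)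
            ((c k).F.divMonomial (c k).r)}) 4).Nonempty ∧
        Nat.factorial 4 < deltaS (fun i => algebraMap (MvPolynomial (Fin 4) K) (OriginLocalization K 4) (∑ t, C (f.2.1 i t) * X t))
          (Ideal.span {algebraMap (MvPolynomial (Fin 4) K) (OriginLocalization K 4)
            ((c k).F.divMonomial (c k).r)}) 4 ∧
        2 * alphaS (fun i => algebraMap (MvPolynomial (Fin 4) K) (OriginLocalization K 4) (∑ t, C (f.2.1 i t) * X t))
          (Ideal.span {algebraMap (MvPolynomial (Fin 4) K) (OriginLocalization K 4)
            ((c k).F.divMonomial (c k).r)}) 4 ≤ Nat.factorial 4) ∧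
      0 < alphaS (fun i => algebraMap (MvPolynomial (Fin 4) K) (OriginLocalization K 4) (∑ t, C (f.2.1 i t) * X t))
        (Ideal.span {algebraMap (MvPolynomial (Fin 4) K) (OriginLocalization K 4)
            ((c k).F.divMonomial (c k).r)}) 4)
    (fun k f => betaS (fun i => algebraMap (MvPolynomial (Fin 4) K) (OriginLocalization K 4) (∑ t, C (f.2.1 i t) * X t))
        (Ideal.span {algebraMap (MvPolynomial (Fin 4) K) (OriginLocalization K 4)
            ((c k).F.divMonomial (c k).r)}) 4)
    ?_ ?_ ?_ (fun _ _ hR => hR.1)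
  · -- E₄: the entry frame
    intro k hk h3
    obtain ⟨⟨W, hW, -⟩, -⟩ := hD k hk
    obtain ⟨L, M, hEk⟩ := hE k (by omega) h3 W hW
    exact ⟨⟨W, L, M⟩, hEk⟩
  · -- L₄: the LOSE-H law
    rintro k hk h3 ⟨h, L, M⟩ hEk
    obtain ⟨L', M', hR', hle⟩ := hL k (by omega) h3 h L M hEk
    exact ⟨⟨j k, L', M'⟩, hR', hle⟩
  · -- K₄: the KEEP-H law = `dInf_stub_keep`
    rintro k hk h2 ⟨h, L, M⟩ hR
    obtain ⟨L', M', hR', hlt⟩ := dInf_stub_keep hc hw hr0 hfloor hshade he (by omega) h2 hR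
    exact ⟨⟨h, L', M'⟩, hR', hlt⟩

/-- **TAIL-D FROM A LIGHT-PAIR KILL, E₄ AND L₄.**  On a witnessed isolated above-floor `Step0 5` chain with `x^{r₀} ∣ F₀`, shade `4`
and `e_G = 2` from `k₀`: if the LIGHT-PAIR branch is contradictory and E₄/L₄ hold on every D∞ branch, then `False` — the
re-presentation-free alternative to `no_dInf_tail_of_representation (hN4D) (hpair)` for this chain. [OURS]
[cite: CossartJannsenSaito2020, Thm. 3.14, Thm. 13.7] -/
theorem tailD_four_five_of_lightPair_of_EL {c : ℕ → State K} {j : ℕ → Fin 4} {b : ℕ → Fin 4 → K}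
    (hc : ∀ k, IsIsolated 5 (c k).F ∧ Step0 5 (c k) (c (k + 1))) (hw : FreeTail.IsWitnessedChain 5 c j b)
    (hr0 : ∀ e ∈ (c 0).F.support, (c 0).r ≤ e) (hfloor : ∀ k, ordZero (c k).F ≠ 5) {k₀ : ℕ}
    (hshade : ∀ k, k₀ ≤ k → (c k).shade = ((4 : ℕ) : ℕ∞))
    (he : ∀ k, k₀ ≤ k → Module.finrank K (resVertex (c k)) = 2)
    (hlight : (∀ k, k₀ ≤ k → (∀ i, (c k).r i ≤ 1) ∧ (c k).r.degree = 2) → False)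
    (hE : ∀ k, k₀ ≤ k → (c k).r.degree = 3 → ∀ (W : Fin 4), (c k).r W = 2 →
      ∃ (L : Fin (2 + 2) → Fin 4 → K) (M : Fin 4 → Fin (2 + 2) → K),
        (∀ t u, ∑ i, M t i * L i u = if t = u then 1 else 0) ∧ L (u1 2) = Pi.single W 1 ∧
        (∀ i, i ≠ u1 2 → i ≠ u2 2 → ∀ w ∈ resVertex (c k), ∑ t, L i t * w t = 0) ∧ (c k).r W = 2 ∧
        (pts (fun i => algebraMap (MvPolynomial (Fin 4) K) (OriginLocalization K 4) (∑ t, C (L i t) * X t))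
          (Ideal.span {algebraMap (MvPolynomial (Fin 4) K) (OriginLocalization K 4)
            ((c k).F.divMonomial (c k).r)}) 4).Nonempty ∧
        Nat.factorial 4 < deltaS (fun i => algebraMap (MvPolynomial (Fin 4) K) (OriginLocalization K 4) (∑ t, C (L i t) * X t))
          (Ideal.span {algebraMap (MvPolynomial (Fin 4) K) (OriginLocalization K 4)
            ((c k).F.divMonomial (c k).r)}) 4 ∧
        2 * alphaS (fun i => algebraMap (MvPolynomial (Fin 4) K) (OriginLocalization K 4) (∑ t, C (L i t) * X t))
          (Ideal.span {algebraMap (MvPolynomial (Fin 4) K) (OriginLocalization K 4)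
            ((c k).F.divMonomial (c k).r)}) 4 ≤ Nat.factorial 4)
    (hL : ∀ k, k₀ ≤ k → (c k).r.degree = 3 → ∀ (h : Fin 4) (L : Fin (2 + 2) → Fin 4 → K) (M : Fin 4 → Fin (2 + 2) → K),
      ((∀ t u, ∑ i, M t i * L i u = if t = u then 1 else 0) ∧ L (u1 2) = Pi.single h 1 ∧
        (∀ i, i ≠ u1 2 → i ≠ u2 2 → ∀ w ∈ resVertex (c k), ∑ t, L i t * w t = 0) ∧ (c k).r h = 2 ∧
        (pts (fun i => algebraMap (MvPolynomial (Fin 4) K) (OriginLocalization K 4) (∑ t, C (L i t) * X t))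
          (Ideal.span {algebraMap (MvPolynomial (Fin 4) K) (OriginLocalization K 4)
            ((c k).F.divMonomial (c k).r)}) 4).Nonempty ∧
        Nat.factorial 4 < deltaS (fun i => algebraMap (MvPolynomial (Fin 4) K) (OriginLocalization K 4) (∑ t, C (L i t) * X t))
          (Ideal.span {algebraMap (MvPolynomial (Fin 4) K) (OriginLocalization K 4)
            ((c k).F.divMonomial (c k).r)}) 4 ∧
        2 * alphaS (fun i => algebraMap (MvPolynomial (Fin 4) K) (OriginLocalization K 4) (∑ t, C (L i t) * X t))
          (Ideal.span {algebraMap (MvPolynomial (Fin 4) K) (OriginLocalization K 4)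
            ((c k).F.divMonomial (c k).r)}) 4 ≤ Nat.factorial 4) →
      ∃ (L' : Fin (2 + 2) → Fin 4 → K) (M' : Fin 4 → Fin (2 + 2) → K),
        (((∀ t u, ∑ i, M' t i * L' i u = if t = u then 1 else 0) ∧ L' (u1 2) = Pi.single (j k) 1 ∧
            (∀ i, i ≠ u1 2 → i ≠ u2 2 → ∀ w ∈ resVertex (c (k + 1)), ∑ t, L' i t * w t = 0) ∧ (c (k + 1)).r (j k) = 2 ∧
            (pts (fun i => algebraMap (MvPolynomial (Fin 4) K) (OriginLocalization K 4) (∑ t, C (L' i t) * X t))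
              (Ideal.span {algebraMap (MvPolynomial (Fin 4) K) (OriginLocalization K 4)
            ((c (k + 1)).F.divMonomial (c (k + 1)).r)}) 4).Nonempty ∧
            Nat.factorial 4 < deltaS (fun i => algebraMap (MvPolynomial (Fin 4) K) (OriginLocalization K 4) (∑ t, C (L' i t) * X t))
              (Ideal.span {algebraMap (MvPolynomial (Fin 4) K) (OriginLocalization K 4)
            ((c (k + 1)).F.divMonomial (c (k + 1)).r)}) 4 ∧
            2 * alphaS (fun i => algebraMap (MvPolynomial (Fin 4) K) (OriginLocalization K 4) (∑ t, C (L' i t) * X t))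
              (Ideal.span {algebraMap (MvPolynomial (Fin 4) K) (OriginLocalization K 4)
            ((c (k + 1)).F.divMonomial (c (k + 1)).r)}) 4 ≤ Nat.factorial 4) ∧
          0 < alphaS (fun i => algebraMap (MvPolynomial (Fin 4) K) (OriginLocalization K 4) (∑ t, C (L' i t) * X t))
            (Ideal.span {algebraMap (MvPolynomial (Fin 4) K) (OriginLocalization K 4)
            ((c (k + 1)).F.divMonomial (c (k + 1)).r)}) 4) ∧
        betaS (fun i => algebraMap (MvPolynomial (Fin 4) K) (OriginLocalization K 4) (∑ t, C (L' i t) * X t))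
          (Ideal.span {algebraMap (MvPolynomial (Fin 4) K) (OriginLocalization K 4)
            ((c (k + 1)).F.divMonomial (c (k + 1)).r)}) 4 ≤
          betaS (fun i => algebraMap (MvPolynomial (Fin 4) K) (OriginLocalization K 4) (∑ t, C (L i t) * X t))
          (Ideal.span {algebraMap (MvPolynomial (Fin 4) K) (OriginLocalization K 4)
            ((c k).F.divMonomial (c k).r)}) 4) : False := by
  rcases four_weights_dichotomy hc hw hr0 hfloor hshade with hLP | ⟨k₁, hk₁, hB⟩
  · exact hlight hLP
  · exact no_dInf_tail_four_five_of_EL hc hw hr0 hfloor hshade he hk₁ hB hE hL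

end ResCone

end Summit.ResolutionOfSingularities.ResolutionOfSingularities.Theorems.PIDim4

end
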